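import Summits.CriticalPhenomena.PercolationContinuityZ3.Theorems.PercNearOneGluingNoHeavyQuantEpsConstants
import HarnessLib

/-!
# QUANT lane / PAPER-2 rate track (ARM-2, gen 11): THE RE-BALANCED TOLERANCE CASCADE of the effective Kozma–Nitzan criterion
# (lever (L1d) of `RATE-CONSTANTS.md` §2j/§8: same inequalities, same Peierls constant, optimal split — `d = 3` defect `2⁻¹⁹⁸⁶ → 2⁻¹⁷⁷⁶`)

builds on p205010 (kernel theorem, internal audit signed; external expert review pending)

Cell `prim-quant`, seat `prim-quant-arm-2` (constants bookkeeper).  The `ε`-parametric cascade of `…QuantEpsCascade`/`…QuantEpsConstants`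
(ARM-2 g3 / ARM-1 g3) fixes ONE admissible choice of the Theorem-6 tolerances as functions of the Peierls constant `ε`:
`δc = ε/16`, `δ₂ = ε/32`, `δ = ε/192`, `δ_corr = ε/(96(d+1))`, `K = ⌈log(8/ε)·32/ε⌉`, `τ₁ = min(δ², δ_corr²) = δ_corr²`, `δ_P = τ₁/2`,
`δ_E = τ₁/(200K)`, `τ_U = δ_E²/2`, window defect `τ_U^{d·2^d}`.  The admissibility inequalities actually CONSUMED by the assembly
(`…QuantEpsScaleDefectOrbit`) are only
  (C1) `δ₂ + 6δ ≤ δc`, (C2) `δc + 6(d+1)δ_corr ≤ ε/8`, (C3) `(1−δ₂)^K ≤ ε/8`,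
  (C5) `δ_P + 44·6δ_E ≤ δc` (aspect 6), (C6) `δ_P + 700·6δ_E ≤ δ_corr²` (aspect 88), (C7) `δ_P + (16K−4)·6δ_E ≤ δ²` (aspect 2K),
  (C8) `τ_U < δ_E²`, `τ_U < δ_P` (strictness for the root trick and the uniqueness zone),
and the tree's choice is tight in (C1)–(C2) but wastes (i) a factor `4` in (C7) by coupling the aspect-`2K` chain to `δ_corr` through `τ₁`
(`δ² = 4δ_corr²` at `d = 3`), (ii) a factor `200/96` by spending `δ_P = τ₁/2` where only `δ_P > τ_U` is needed, and (iii) the budget split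
`ε/16 : ε/16` of (C2) and `ε/32 : ε/32` of (C1).  RESIDUAL-SLACK CENSUS (`quant/prim-quant-arm-2-g11/code/slack_census.py`): the optimum of
`log₂(1/τ_U^{24})` over all splits of (C1)–(C8) at `ε = 2⁻³`, `d = 3` is `≈ 1 745` bits against the tree's `1 985.8`; the clean rational
re-balancing of this file reaches **`1 775.4`** (kernel: `(1/2)^1776 < rsTauU 2⁻³ 3 ^ 24 < (1/2)^1775`):

* `rsDeltaCorr ε d = ε/(140(d+1))`, `rsDeltaC ε = 23ε/280`, `rsDelta ε = ε/105`, `rsDelta2 ε = ε/40` ((C1), (C2) with EQUALITY),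
  `rsK ε = max 64 ⌈log(8/ε)·40/ε⌉` ((C3)), **`rsDeltaE ε d = min(δ²/(100K), δ_corr²/4800)`** (decoupled (C7), (C6)), `rsDeltaP = rsDeltaE`,
  `rsTauU = δ_E²/2`; every side condition of `…QuantEpsConstants` re-proved under the same names with prefix `rs` (§2);
* §3 the COMPARISON with the `eps`-cascade at `ε/2` — `rsK ε ≤ epsK (ε/2)`, `epsDelta (ε/2) ≤ rsDelta ε`, `epsDeltaCorr (ε/2) d ≤ rsDeltaCorr ε d`,
  `epsDeltaE (ε/2) d ≤ rsDeltaE ε d`, `epsTauU (ε/2) d ≤ rsTauU ε d` — which lets the assembly (`…QuantResplitScaleDefect`) BORROW every scale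
  (`epsM`, `epsSeeds`, `epsRad`, …, `epsS`) from the `eps`-cascade at `ε/2` instead of defining new ones, and makes the window bridge
  `25·rsK ε·epsS (ε/2) ≤ epsLHi (ε/2) ≤ knLHi` one line;
* NUMERALS (`…QuantResplitNumerals`) at `ε = 2⁻³` (the display of record's Peierls constant, ARM-2 g7 `StarPeierls.theta_slab_pos_three`): `rsK 2⁻³ ≤ 1331`, the corridor
  branch of the `min` binds for `d ≥ 3` (`rsDeltaE 2⁻³ d = 1/(6 021 120 000·(d+1)²)`), and the SHARP orbit sandwiches
  **`(1/2)^1776 < rsTauU 2⁻³ 3 ^ 24 < (1/2)^1775`**, `d = 4/5/6`: `4817/4816`, `12211/12210`, `29647/29646` (tree at `2⁻³`: `1986`, `5378`, `13613`, `33013`).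
HONEST FRAMING: a re-balancing of OUR constants inside the SAME proof (Kozma–Nitzan Theorem 6 effective + DKT + BGN, Peierls constant `2⁻³`);
the class of the rate (iterated logarithm) and the honest sentence are UNCHANGED; the `d = 3` display base moves `1 − 2⁻¹⁹⁸⁶ → 1 − 2⁻¹⁷⁷⁶`
once `…QuantResplitScaleDefect` lands (this file alone moves no rate).  The Literature-level split of KN's (33) (`ε/8 + ε/8` per direction,
`KSch.fail_bound`) is kept frozen; freeing it too would give `≈ 1 650` (census, not pursued).
[cite: KozmaNitzan2024, §4 (pp. 15–31)] [cite: DuminilcopinKozmaTassion2020, Proposition 1]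
-/

noncomputable section

namespace Summit.CriticalPhenomena.PercolationContinuityZ3.Theorems.Quant

open MeasureTheory Literature.Probability.Percolation Literature.Probability.LatticeModels
open Literature.Probability.Percolation.KozmaNitzan Literature.Probability.Percolation.AKN

variable {d : ℕ} {ε : ℝ}

/-! ## §1. The re-balanced tolerances as functions of `ε` -/

/-- Corridor tolerance `δ_corr(ε) = ε/(140(d+1))` (Lemma 12 internal; tree `ε/(96(d+1))`). [cite: KozmaNitzan2024, §4 Lemma 12] -/
def rsDeltaCorr (ε : ℝ) (d : ℕ) : ℝ := ε / (140 * ((d : ℝ) + 1))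

/-- Goodness threshold `δc(ε) = 23ε/280` (tree `ε/16`; (C2) `δc + 6(d+1)δ_corr = ε/8`). [cite: KozmaNitzan2024, §4 p. 26] -/
def rsDeltaC (ε : ℝ) : ℝ := 23 * ε / 280

/-- Thin tolerance of the aspect-`2K` target family `δ(ε) = ε/105` (tree `ε/192`). [cite: KozmaNitzan2024, §4 Lemma 10] -/
def rsDelta (ε : ℝ) : ℝ := ε / 105

/-- Input tolerance of the aspect-`2K` target step `δ₂(ε) = ε/40` (tree `ε/32`; (C1) `δ₂ + 6δ = δc`). [cite: KozmaNitzan2024, §4 p. 30] -/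
def rsDelta2 (ε : ℝ) : ℝ := ε / 40

/-- Number of stub levels `K(ε) = max 64 ⌈log(8/ε)·40/ε⌉` (`(1−δ₂)^K ≤ ε/8`; tree `⌈log(8/ε)·32/ε⌉`). [cite: KozmaNitzan2024, §4 p. 26] -/
def rsK (ε : ℝ) : ℕ := max 64 ⌈Real.log (8 / ε) * (40 / ε)⌉₊

/-- **The internal tolerance of the Lemma-11 chains `δ_E(ε) = min(δ²/(100K), δ_corr²/4800)`** — the aspect-`2K` chain and the corridor
chain DECOUPLED (tree: `min(δ², δ_corr²)/(200K)`). [cite: KozmaNitzan2024, §4 Lemma 11] -/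
def rsDeltaE (ε : ℝ) (d : ℕ) : ℝ := min (rsDelta ε ^ 2 / (100 * (rsK ε : ℝ))) (rsDeltaCorr ε d ^ 2 / 4800)

/-- Face-linking tolerance of Lemma 11, `δ_P(ε) := δ_E(ε)` (tree: `τ₁/2`; only `δ_P > τ_U` and the losses (C5)–(C7) are needed). [cite: KozmaNitzan2024, §4 Lemma 11] -/
def rsDeltaP (ε : ℝ) (d : ℕ) : ℝ := rsDeltaE ε d

/-- Uniqueness / primitive tolerance `τ_U(ε) = δ_E²/2`. [cite: KozmaNitzan2024, §4 Theorem 6] -/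
def rsTauU (ε : ℝ) (d : ℕ) : ℝ := rsDeltaE ε d ^ 2 / 2

/-! ## §2. Arithmetic side conditions (the names mirror `…QuantEpsConstants`) -/

/-- `0 < δ_corr`. [folklore] -/
theorem rsDeltaCorr_pos (d : ℕ) (hε0 : 0 < ε) : 0 < rsDeltaCorr ε d := by unfold rsDeltaCorr; positivity
/-- `δ_corr ≤ 1` for `ε ≤ 1`. [folklore] -/
theorem rsDeltaCorr_le_one (d : ℕ) (hε1 : ε ≤ 1) : rsDeltaCorr ε d ≤ 1 := by
  unfold rsDeltaCorr
  have hd : (1 : ℝ) ≤ 140 * ((d : ℝ) + 1) := by have : (0 : ℝ) ≤ d := Nat.cast_nonneg d; linarith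
  rw [div_le_one (by linarith)]; linarith
/-- `0 < δc`. [folklore] -/
theorem rsDeltaC_pos (hε0 : 0 < ε) : 0 < rsDeltaC ε := by unfold rsDeltaC; positivity
/-- `δc ≤ 1` for `ε ≤ 1`. [folklore] -/
theorem rsDeltaC_le_one (hε1 : ε ≤ 1) : rsDeltaC ε ≤ 1 := by unfold rsDeltaC; linarith
/-- `0 < δ`. [folklore] -/
theorem rsDelta_pos (hε0 : 0 < ε) : 0 < rsDelta ε := by unfold rsDelta; positivity
/-- `δ ≤ 1` for `ε ≤ 1`. [folklore] -/
theorem rsDelta_le_one (hε1 : ε ≤ 1) : rsDelta ε ≤ 1 := by unfold rsDelta; linarith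
/-- `0 < δ₂`. [folklore] -/
theorem rsDelta2_pos (hε0 : 0 < ε) : 0 < rsDelta2 ε := by unfold rsDelta2; positivity
/-- `δ₂ ≤ 1` for `ε ≤ 1`. [folklore] -/
theorem rsDelta2_le_one (hε1 : ε ≤ 1) : rsDelta2 ε ≤ 1 := by unfold rsDelta2; linarith

/-- **(C1) with equality**: `δ₂ + 6δ ≤ δc` (`ε/40 + 6ε/105 = 23ε/280`). [folklore] -/
theorem rsDelta2_add (ε : ℝ) : rsDelta2 ε + 6 * rsDelta ε ≤ rsDeltaC ε := by
  unfold rsDelta2 rsDelta rsDeltaC; linarith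

/-- **(C2) with equality**: `δc + 6(d+1)δ_corr ≤ ε/8` (`23ε/280 + 6ε/140 = ε/8`). [folklore] -/
theorem rsDeltaC_add (ε : ℝ) (d : ℕ) : rsDeltaC ε + 6 * ((d : ℝ) + 1) * rsDeltaCorr ε d ≤ ε / 8 := by
  unfold rsDeltaC rsDeltaCorr
  have hd : (0 : ℝ) < (d : ℝ) + 1 := by positivity
  have : 6 * ((d : ℝ) + 1) * (ε / (140 * ((d : ℝ) + 1))) = 6 * ε / 140 := by field_simp
  rw [this]; linarith

/-- `64 ≤ K(ε)`. [folklore] -/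
theorem rsK_ge (ε : ℝ) : 64 ≤ rsK ε := le_max_left _ _
/-- `20 ≤ K(ε)`. [folklore] -/
theorem rsK_ge_twenty (ε : ℝ) : 20 ≤ rsK ε := le_trans (by norm_num) (rsK_ge ε)
/-- `0 < K(ε)`. [folklore] -/
theorem rsK_pos (ε : ℝ) : 0 < rsK ε := lt_of_lt_of_le (by norm_num) (rsK_ge ε)

/-- **(C3)**: `(1 - δ₂)^K + ε/8 ≤ ε/4` for every `0 < ε ≤ 1` (`K·δ₂ ≥ log(8/ε)`). [cite: KozmaNitzan2024, §4 p. 26] -/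
theorem rsK_pow (hε0 : 0 < ε) (hε1 : ε ≤ 1) : (1 - rsDelta2 ε) ^ rsK ε + ε / 8 ≤ ε / 4 := by
  have h1 : (1 - rsDelta2 ε) ^ rsK ε ≤ Real.exp (-((rsK ε : ℝ) * rsDelta2 ε)) := by
    have h0 : 1 - rsDelta2 ε ≤ Real.exp (-rsDelta2 ε) := by have := Real.add_one_le_exp (-rsDelta2 ε); linarith
    calc (1 - rsDelta2 ε) ^ rsK ε ≤ Real.exp (-rsDelta2 ε) ^ rsK ε :=
          pow_le_pow_left₀ (by have := rsDelta2_le_one hε1; linarith) h0 (rsK ε)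
      _ = Real.exp (-((rsK ε : ℝ) * rsDelta2 ε)) := by rw [← Real.exp_nat_mul]; ring_nf
  have hK : Real.log (8 / ε) ≤ (rsK ε : ℝ) * rsDelta2 ε := by
    have hc : Real.log (8 / ε) * (40 / ε) ≤ rsK ε :=
      (Nat.le_ceil _).trans (by exact_mod_cast le_max_right 64 _)
    have : (rsK ε : ℝ) * rsDelta2 ε = (rsK ε : ℝ) * (ε / 40) := by unfold rsDelta2; rfl
    rw [this]
    have := mul_le_mul_of_nonneg_right hc (show (0:ℝ) ≤ ε / 40 by positivity)
    have e : Real.log (8 / ε) * (40 / ε) * (ε / 40) = Real.log (8 / ε) := by field_simp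
    linarith [e]
  have h2 : Real.exp (-((rsK ε : ℝ) * rsDelta2 ε)) ≤ ε / 8 := by
    rw [← Real.exp_log (show 0 < ε / 8 by positivity)]
    apply Real.exp_le_exp.2
    have : Real.log (ε / 8) = -Real.log (8 / ε) := by
      rw [← Real.log_inv]; congr 1; field_simp
    linarith
  linarith

/-- `0 < δ_E`. [folklore] -/
theorem rsDeltaE_pos (d : ℕ) (hε0 : 0 < ε) : 0 < rsDeltaE ε d := by
  unfold rsDeltaE
  have := rsDelta_pos hε0; have := rsDeltaCorr_pos d hε0
  have hK : (0 : ℝ) < rsK ε := by exact_mod_cast rsK_pos ε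
  exact lt_min (by positivity) (by positivity)
/-- `δ_E ≤ δ²/(100K)` (the aspect-`2K` branch). [folklore] -/
theorem rsDeltaE_le_delta_sq_div (ε : ℝ) (d : ℕ) : rsDeltaE ε d ≤ rsDelta ε ^ 2 / (100 * (rsK ε : ℝ)) := min_le_left _ _
/-- `δ_E ≤ δ_corr²/4800` (the corridor branch). [folklore] -/
theorem rsDeltaE_le_deltaCorr_sq_div (ε : ℝ) (d : ℕ) : rsDeltaE ε d ≤ rsDeltaCorr ε d ^ 2 / 4800 := min_le_right _ _
/-- `δ_E ≤ δ²`. [folklore] -/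
theorem rsDeltaE_le_delta_sq (ε : ℝ) (d : ℕ) : rsDeltaE ε d ≤ rsDelta ε ^ 2 := by
  refine (rsDeltaE_le_delta_sq_div ε d).trans ?_
  have hK : (64 : ℝ) ≤ rsK ε := by exact_mod_cast rsK_ge ε
  exact div_le_self (sq_nonneg _) (by linarith)
/-- `δ_E ≤ δ_corr²`. [folklore] -/
theorem rsDeltaE_le_deltaCorr_sq (ε : ℝ) (d : ℕ) : rsDeltaE ε d ≤ rsDeltaCorr ε d ^ 2 :=
  (rsDeltaE_le_deltaCorr_sq_div ε d).trans (div_le_self (sq_nonneg _) (by norm_num))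
/-- `δ_E ≤ δ` for `0 < ε ≤ 1`. [folklore] -/
theorem rsDeltaE_le_delta (d : ℕ) (hε0 : 0 < ε) (hε1 : ε ≤ 1) : rsDeltaE ε d ≤ rsDelta ε := by
  refine (rsDeltaE_le_delta_sq ε d).trans ?_
  have h0 := rsDelta_pos hε0; have h1 := rsDelta_le_one hε1
  nlinarith
/-- `δ_E ≤ δ_corr` for `0 < ε ≤ 1`. [folklore] -/
theorem rsDeltaE_le_deltaCorr (d : ℕ) (hε0 : 0 < ε) (hε1 : ε ≤ 1) : rsDeltaE ε d ≤ rsDeltaCorr ε d := by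
  refine (rsDeltaE_le_deltaCorr_sq ε d).trans ?_
  have h0 := rsDeltaCorr_pos d hε0; have h1 := rsDeltaCorr_le_one d hε1
  nlinarith
/-- `δ_E < 1` for `0 < ε ≤ 1`. [folklore] -/
theorem rsDeltaE_lt_one (d : ℕ) (hε0 : 0 < ε) (hε1 : ε ≤ 1) : rsDeltaE ε d < 1 := by
  have h := rsDeltaE_le_deltaCorr_sq_div ε d
  have h0 := rsDeltaCorr_pos d hε0; have h1 := rsDeltaCorr_le_one d hε1
  have : rsDeltaCorr ε d ^ 2 ≤ 1 := by nlinarith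
  linarith
/-- `δ_E² < δ_E` for `0 < ε ≤ 1`. [folklore] -/
theorem rsDeltaE_sq_lt (d : ℕ) (hε0 : 0 < ε) (hε1 : ε ≤ 1) : rsDeltaE ε d ^ 2 < rsDeltaE ε d := by
  have h0 := rsDeltaE_pos d hε0; have h1 := rsDeltaE_lt_one d hε0 hε1; nlinarith
/-- `0 < δ_P`. [folklore] -/
theorem rsDeltaP_pos (d : ℕ) (hε0 : 0 < ε) : 0 < rsDeltaP ε d := rsDeltaE_pos d hε0
/-- `δ_P = δ_E`. [folklore] -/
theorem rsDeltaP_eq (ε : ℝ) (d : ℕ) : rsDeltaP ε d = rsDeltaE ε d := rfl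

/-- **(C5)**, loss at aspect `6`: `δ_P + (8·6−4)·6δ_E ≤ δc` (`265 δ_E ≤ 265 δ_corr²/4800 ≤ δ_corr ≤ 23ε/280`). [folklore] -/
theorem rsLoss6 (d : ℕ) (hε0 : 0 < ε) (hε1 : ε ≤ 1) :
    rsDeltaP ε d + ((8 * 6 - 4 : ℕ) : ℝ) * (6 * rsDeltaE ε d) ≤ rsDeltaC ε := by
  rw [rsDeltaP_eq]
  have h := rsDeltaE_le_deltaCorr_sq_div ε d
  have h0 := rsDeltaCorr_pos d hε0; have h1 := rsDeltaCorr_le_one d hε1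
  have hcorr : rsDeltaCorr ε d ≤ ε / 140 := by
    unfold rsDeltaCorr
    have : (0 : ℝ) ≤ d := Nat.cast_nonneg d
    exact div_le_div_of_nonneg_left hε0.le (by norm_num) (by nlinarith)
  have hsq : rsDeltaCorr ε d ^ 2 ≤ rsDeltaCorr ε d := by nlinarith
  unfold rsDeltaC; push_cast; nlinarith

/-- **(C6)**, loss at aspect `88`: `δ_P + (8·88−4)·6δ_E ≤ δ_corr²` (`4201 δ_E ≤ 4201 δ_corr²/4800`). [folklore] -/
theorem rsLoss88 (d : ℕ) (hε0 : 0 < ε) :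
    rsDeltaP ε d + ((8 * 88 - 4 : ℕ) : ℝ) * (6 * rsDeltaE ε d) ≤ rsDeltaCorr ε d ^ 2 := by
  rw [rsDeltaP_eq]
  have h := rsDeltaE_le_deltaCorr_sq_div ε d
  have h0 := pow_pos (rsDeltaCorr_pos d hε0) 2
  push_cast; nlinarith

/-- **(C7)**, loss at aspect `2K`: `δ_P + (16K−4)·6δ_E ≤ δ²` (`(96K−23)δ_E ≤ 96K·δ²/(100K)`). [folklore] -/
theorem rsLoss2K (d : ℕ) (hε0 : 0 < ε) :
    rsDeltaP ε d + ((8 * (2 * rsK ε) - 4 : ℕ) : ℝ) * (6 * rsDeltaE ε d) ≤ rsDelta ε ^ 2 := by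
  rw [rsDeltaP_eq]
  have h := rsDeltaE_le_delta_sq_div ε d
  have hE := rsDeltaE_pos d hε0
  have hK : (64 : ℝ) ≤ rsK ε := by exact_mod_cast rsK_ge ε
  have hcast : ((8 * (2 * rsK ε) - 4 : ℕ) : ℝ) ≤ 16 * (rsK ε : ℝ) := by
    have : 8 * (2 * rsK ε) - 4 ≤ 16 * rsK ε := by omega
    exact_mod_cast this
  have h1 : ((8 * (2 * rsK ε) - 4 : ℕ) : ℝ) * (6 * rsDeltaE ε d) ≤ 96 * (rsK ε : ℝ) * rsDeltaE ε d := by nlinarith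
  have h2 : rsDeltaE ε d + 96 * (rsK ε : ℝ) * rsDeltaE ε d ≤ 100 * (rsK ε : ℝ) * rsDeltaE ε d := by nlinarith
  have h3 : 100 * (rsK ε : ℝ) * rsDeltaE ε d ≤ rsDelta ε ^ 2 := by
    have := mul_le_mul_of_nonneg_left h (show (0 : ℝ) ≤ 100 * (rsK ε : ℝ) by positivity)
    have e : 100 * (rsK ε : ℝ) * (rsDelta ε ^ 2 / (100 * (rsK ε : ℝ))) = rsDelta ε ^ 2 := by field_simp
    linarith [e]
  linarith

/-- `0 < τ_U`. [folklore] -/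
theorem rsTauU_pos (d : ℕ) (hε0 : 0 < ε) : 0 < rsTauU ε d := by
  unfold rsTauU; have := rsDeltaE_pos d hε0; positivity
/-- **(C8)** `τ_U < δ_E²`. [folklore] -/
theorem rsTauU_lt (d : ℕ) (hε0 : 0 < ε) : rsTauU ε d < rsDeltaE ε d ^ 2 := by
  unfold rsTauU; have := pow_pos (rsDeltaE_pos d hε0) 2; linarith
/-- **(C8)** `τ_U < δ_P`. [folklore] -/
theorem rsTauU_lt_deltaP (d : ℕ) (hε0 : 0 < ε) (hε1 : ε ≤ 1) : rsTauU ε d < rsDeltaP ε d :=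
  (rsTauU_lt d hε0).trans (rsDeltaE_sq_lt d hε0 hε1)
/-- `τ_U ≤ 1` for `0 < ε ≤ 1`. [folklore] -/
theorem rsTauU_le_one (d : ℕ) (hε0 : 0 < ε) (hε1 : ε ≤ 1) : rsTauU ε d ≤ 1 := by
  have h1 := rsTauU_lt d hε0; have h2 := rsDeltaE_sq_lt d hε0 hε1; have h3 := rsDeltaE_lt_one d hε0 hε1; linarith

/-! ### The orbit window defect `τ_U^{d·2^d}` and its root-trick side conditions -/

/-- `0 < τ_U^{d·2^d}`. [folklore] -/
theorem rsTauU_pow_orbit_pos (d : ℕ) (hε0 : 0 < ε) : 0 < rsTauU ε d ^ (d * 2 ^ d) := pow_pos (rsTauU_pos d hε0) _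
/-- `τ_U^{d·2^d} ≤ 1`. [folklore] -/
theorem rsTauU_pow_orbit_le_one (d : ℕ) (hε0 : 0 < ε) (hε1 : ε ≤ 1) : rsTauU ε d ^ (d * 2 ^ d) ≤ 1 :=
  pow_le_one₀ (rsTauU_pos d hε0).le (rsTauU_le_one d hε0 hε1)
/-- The orbit square-root trick returns `τ_U`: `(τ_U^{d·2^d})^{1/(d·2^d)} = τ_U` (`d ≥ 1`). [folklore] -/
theorem rsTauU_pow_rpow_orbit (hd : 1 ≤ d) (hε0 : 0 < ε) :
    (rsTauU ε d ^ (d * 2 ^ d)) ^ (((d * 2 ^ d : ℕ) : ℝ)⁻¹) = rsTauU ε d := by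
  have hn : d * 2 ^ d ≠ 0 := Nat.mul_ne_zero (by omega) (pow_ne_zero _ (by norm_num))
  exact Real.pow_rpow_inv_natCast (rsTauU_pos d hε0).le hn
/-- Side condition: `(τ_U^{d·2^d})^{1/(d·2^d)} < δ_E²`. [folklore] -/
theorem rsTauU_pow_rpow_orbit_lt_deltaE_sq (hd : 1 ≤ d) (hε0 : 0 < ε) :
    (rsTauU ε d ^ (d * 2 ^ d)) ^ (((d * 2 ^ d : ℕ) : ℝ)⁻¹) < rsDeltaE ε d ^ 2 := by
  rw [rsTauU_pow_rpow_orbit hd hε0]; exact rsTauU_lt d hε0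
/-- Side condition: `(τ_U^{d·2^d})^{1/(d·2^d)} < δ_P`. [folklore] -/
theorem rsTauU_pow_rpow_orbit_lt_deltaP (hd : 1 ≤ d) (hε0 : 0 < ε) (hε1 : ε ≤ 1) :
    (rsTauU ε d ^ (d * 2 ^ d)) ^ (((d * 2 ^ d : ℕ) : ℝ)⁻¹) < rsDeltaP ε d := by
  rw [rsTauU_pow_rpow_orbit hd hε0]; exact rsTauU_lt_deltaP d hε0 hε1
/-- Side condition: `(τ_U^{d·2^d})^{1/(d·2^d)} < δ_corr²`. [folklore] -/
theorem rsTauU_pow_rpow_orbit_lt_deltaCorr_sq (hd : 1 ≤ d) (hε0 : 0 < ε) (hε1 : ε ≤ 1) :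
    (rsTauU ε d ^ (d * 2 ^ d)) ^ (((d * 2 ^ d : ℕ) : ℝ)⁻¹) < rsDeltaCorr ε d ^ 2 := by
  rw [rsTauU_pow_rpow_orbit hd hε0]
  exact (rsTauU_lt_deltaP d hε0 hε1).trans_le (rsDeltaE_le_deltaCorr_sq ε d)
/-- Side condition: `(τ_U^{d·2^d})^{1/(d·2^d)} < δ²`. [folklore] -/
theorem rsTauU_pow_rpow_orbit_lt_delta_sq (hd : 1 ≤ d) (hε0 : 0 < ε) (hε1 : ε ≤ 1) :
    (rsTauU ε d ^ (d * 2 ^ d)) ^ (((d * 2 ^ d : ℕ) : ℝ)⁻¹) < rsDelta ε ^ 2 := by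
  rw [rsTauU_pow_rpow_orbit hd hε0]
  exact (rsTauU_lt_deltaP d hε0 hε1).trans_le (rsDeltaE_le_delta_sq ε d)

/-! ## §3. Comparison with the `eps`-cascade at `ε/2` (the scales of `…QuantEpsConstants` at `ε/2` are large enough) -/

/-- `K_rs(ε) ≤ K_eps(ε/2)` (`40·log(8/ε) ≤ 64·log(16/ε)`), `0 < ε ≤ 1`. [folklore] -/
theorem rsK_le_epsK_half (hε0 : 0 < ε) (hε1 : ε ≤ 1) : rsK ε ≤ epsK (ε / 2) := by
  unfold rsK epsK
  refine max_le_max_left 64 (Nat.ceil_mono ?_)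
  have hlog0 : 0 ≤ Real.log (8 / ε) := Real.log_nonneg (by rw [le_div_iff₀ hε0]; linarith)
  have hlog : Real.log (8 / ε) ≤ Real.log (8 / (ε / 2)) :=
    Real.log_le_log (by positivity) (by rw [div_le_div_iff₀ hε0 (by positivity)]; nlinarith)
  have h40 : 40 / ε ≤ 32 / (ε / 2) := by rw [div_le_div_iff₀ hε0 (by positivity)]; nlinarith
  exact mul_le_mul hlog h40 (by positivity) (hlog0.trans hlog)

/-- `δ_eps(ε/2) = ε/384 ≤ δ_rs(ε) = ε/105` (`ε ≥ 0`). [folklore] -/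
theorem epsDelta_half_le_rsDelta (hε0 : 0 ≤ ε) : epsDelta (ε / 2) ≤ rsDelta ε := by
  unfold epsDelta rsDelta; rw [div_div, div_le_div_iff₀ (by norm_num) (by norm_num)]; nlinarith

/-- `δ_corr,eps(ε/2) = ε/(192(d+1)) ≤ δ_corr,rs(ε) = ε/(140(d+1))` (`ε ≥ 0`). [folklore] -/
theorem epsDeltaCorr_half_le_rsDeltaCorr (d : ℕ) (hε0 : 0 ≤ ε) : epsDeltaCorr (ε / 2) d ≤ rsDeltaCorr ε d := by
  unfold epsDeltaCorr rsDeltaCorr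
  have hd : (0 : ℝ) < (d : ℝ) + 1 := by positivity
  rw [div_div, div_le_div_iff₀ (by positivity) (by positivity)]; nlinarith

/-- **`δ_E,eps(ε/2) ≤ δ_E,rs(ε)`** (`d ≥ 1`, `0 < ε ≤ 1`): `ε²/(4·(96(d+1))²·200K₂) ≤ min(ε²/(105²·100K₁), ε²/(4800·(140(d+1))²))` with
`K₁ = K_rs(ε) ≤ K₂ = K_eps(ε/2)` and `K₂ ≥ 64`. [folklore] -/
theorem epsDeltaE_half_le_rsDeltaE (hd : 1 ≤ d) (hε0 : 0 < ε) (hε1 : ε ≤ 1) : epsDeltaE (ε / 2) d ≤ rsDeltaE ε d := by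
  have hK12 : (rsK ε : ℝ) ≤ epsK (ε / 2) := by exact_mod_cast rsK_le_epsK_half hε0 hε1
  have hK2 : (64 : ℝ) ≤ epsK (ε / 2) := by exact_mod_cast epsK_ge (ε / 2)
  have hK1 : (64 : ℝ) ≤ rsK ε := by exact_mod_cast rsK_ge ε
  have hd1 : (1 : ℝ) ≤ d := by exact_mod_cast hd
  -- closed form of the `eps` tolerance at `ε/2`
  have heps : epsDeltaE (ε / 2) d = ε ^ 2 / (4 * (96 * ((d : ℝ) + 1)) ^ 2 * (200 * (epsK (ε / 2) : ℝ))) := by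
    unfold epsDeltaE; rw [epsTau1_eq hd]; unfold epsDeltaCorr
    have h0 : (0 : ℝ) < 96 * ((d : ℝ) + 1) := by positivity
    field_simp; ring
  rw [heps]
  unfold rsDeltaE rsDelta rsDeltaCorr
  set D : ℝ := (d : ℝ) + 1 with hD
  have hD1 : (2 : ℝ) ≤ D := by rw [hD]; linarith
  have hε2 : 0 < ε ^ 2 := by positivity
  refine le_min ?_ ?_
  · -- aspect-2K branch: `4·96²·D²·200·K₂ ≥ 105²·100·K₁`
    rw [div_pow, div_div, div_le_div_iff₀ (by positivity) (by positivity)]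
    have hsq : (192 : ℝ) ^ 2 ≤ (96 * D) ^ 2 := by nlinarith
    have h1 : (105 : ℝ) ^ 2 * (100 * (rsK ε : ℝ)) ≤ 4 * (96 * D) ^ 2 * (200 * (epsK (ε / 2) : ℝ)) :=
      calc (105 : ℝ) ^ 2 * (100 * (rsK ε : ℝ)) ≤ (105 : ℝ) ^ 2 * (100 * (epsK (ε / 2) : ℝ)) := by nlinarith
        _ ≤ 4 * (192 : ℝ) ^ 2 * (200 * (epsK (ε / 2) : ℝ)) := by nlinarith
        _ ≤ 4 * (96 * D) ^ 2 * (200 * (epsK (ε / 2) : ℝ)) := by nlinarith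
    nlinarith [mul_le_mul_of_nonneg_left h1 hε2.le]
  · -- corridor branch: `4·96²·D²·200·K₂ ≥ 4800·140²·D²` (i.e. `K₂ ≥ 12.76`)
    rw [div_pow, div_div, div_le_div_iff₀ (by positivity) (by positivity)]
    have h1 : (140 * D) ^ 2 * (4800 : ℝ) ≤ 4 * (96 * D) ^ 2 * (200 * (epsK (ε / 2) : ℝ)) := by nlinarith
    nlinarith

/-- **`τ_U,eps(ε/2) ≤ τ_U,rs(ε)`** (`d ≥ 1`, `0 < ε ≤ 1`): the re-balanced defect is the LARGER one, and the `eps`-uniqueness zone at `ε/2`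
(`uniq_epsM_criticalProbI`) serves the re-balanced assembly. [folklore] -/
theorem epsTauU_half_le_rsTauU (hd : 1 ≤ d) (hε0 : 0 < ε) (hε1 : ε ≤ 1) : epsTauU (ε / 2) d ≤ rsTauU ε d := by
  unfold epsTauU rsTauU
  have h := epsDeltaE_half_le_rsDeltaE hd hε0 hε1
  have h0 := (epsDeltaE_pos d (show 0 < ε / 2 by positivity)).le
  have := pow_le_pow_left₀ h0 h (2 : ℕ)
  linarith

/-- The orbit defects compare the same way: `τ_U,eps(ε/2)^{d·2^d} ≤ τ_U,rs(ε)^{d·2^d}`. [folklore] -/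
theorem epsTauU_half_pow_le_rsTauU_pow (hd : 1 ≤ d) (hε0 : 0 < ε) (hε1 : ε ≤ 1) :
    epsTauU (ε / 2) d ^ (d * 2 ^ d) ≤ rsTauU ε d ^ (d * 2 ^ d) :=
  pow_le_pow_left₀ (epsTauU_pos_of_pos d (by positivity)).le (epsTauU_half_le_rsTauU hd hε0 hε1) _

end Summit.CriticalPhenomena.PercolationContinuityZ3.Theorems.Quant

end
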